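import Mathlib
import Literature.LinearAlgebra.Matrix.CrossInterpolation
import Literature.LinearAlgebra.Matrix.MaximalVolumeErrorBounds
import Literature.LinearAlgebra.Matrix.AdaptiveCrossApproximation

/-!
# Growth of the inverse pivot block under adaptive cross approximation

One step of adaptive cross approximation (ACA) borders the pivot block `P = A[r, c]`
(`r : Fin k → m`, `c : Fin k → n`, `IsUnit P.det`) by a new pivot row `i` and pivot column `j`
with nonzero residual `γ = (A - Ã) i j`, `Ã = crossInterp A r c = A[:, c] P⁻¹ A[r, :]`.  This file
records, over a field,

* the BORDERED INVERSE: the inverse of the new pivot block `P' = A[(i, r), (j, c)]` in terms of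
  `P⁻¹`, `γ⁻¹`, the column coefficients `w = (A[:, c] P⁻¹) i ·` of the new pivot row and the row
  coefficients `u = (P⁻¹ A[r, :]) · j` of the new pivot column
  (`inv_submatrix_vecCons_vecCons_eq`: `P'⁻¹ = [[γ⁻¹, -γ⁻¹ w], [-u γ⁻¹, P⁻¹ + u γ⁻¹ w]]` in the
  `vecCons` indexing, new pivot first) — the partitioned-inverse formula
  [HornJohnson2013, §0.7.3] specialised to a bordering by one row and one column, "verified by
  doing a partitioned multiplication … and then simplifying"; the corner entry `γ⁻¹` is
  `inv_submatrix_vecCons_vecCons_apply_zero_zero` of `MaximalVolumeErrorBounds`;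
* the ENTRY-SUM RECURSION for `P'⁻¹` over a normed field
  (`sum_norm_inv_submatrix_vecCons_vecCons_le`):
  `Σ ‖P'⁻¹‖ ≤ Σ ‖P⁻¹‖ + ‖γ‖⁻¹ (1 + Σ_s ‖u_s‖) (1 + Σ_t ‖w_t‖)`, and its form under ROOK (a
  fortiori complete) pivoting, where `‖u_s‖, ‖w_s‖ ≤ 2^s` [Bebendorf2000, Lemma 6] give
  `Σ ‖P'⁻¹‖ ≤ Σ ‖P⁻¹‖ + 4^k / ‖γ‖` (`IsRookPivoted.sum_norm_inv_submatrix_vecCons_vecCons_le`).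
  Iterated along a completely pivoted sequence with pivots `p₁, …, p_{m+1}` this is the growth
  estimate `‖A₁₁⁻¹‖_{∞→1} ≤ Σ_t 4^t / |p_{t+1}|` behind [CortinovisKressnerMassei2020, §3.1,
  proof of Theorem 7] (there: `‖L₁₁⁻¹‖_{∞→1} ≤ (2^{m+1} - 1) / min |p_t|` "by induction on `m`",
  `‖U₁₁⁻¹‖_{1→1} ≤ 2^m`, hence `‖A₁₁⁻¹‖ ≤ 2^{2m+1} / min |p_t|`); the entry sum dominates the
  `∞ → 1` operator norm;
* the DISTANCE-TO-SINGULARITY inequality in entry-sum form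
  (`one_le_mul_sum_norm_inv_of_det_eq_zero`): if `P` is nonsingular, `F` is singular and
  `‖P - F‖_max ≤ δ`, then `1 ≤ δ · Σ_{a,b} ‖P⁻¹ a b‖` — the exercise preceding
  [HornJohnson2013, Corollary 5.6.17] ("if `A` is nonsingular and `A + B` is singular then
  `|||B||| ≥ 1/|||A⁻¹|||`") in the form used as `γ_{n-1}(A) = ‖A⁻¹‖⁻¹_{∞→1}` in
  [CortinovisKressnerMassei2020, §3.1].

Together with `k + 1 > rank F ⇒ det F[(i, r), (j, c)] = 0`
(`det_submatrix_eq_zero_of_rank_lt_card` of `RankMinors`) these are the three ingredients of the a-priori error bounds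
for cross approximation with complete pivoting in the Chebyshev norm
[CortinovisKressnerMassei2020, Theorems 6–7]; the iteration along a pivot sequence (which needs
a lower bound on the pivots, i.e. the growth factor `ρ_m`) is carried out for symmetric positive
semidefinite matrices — where the pivots are non-increasing and `ρ_m = 1`
[CortinovisKressnerMassei2020, §3.2] — in `PivotedCholeskyErrorBound`.

NOT formalised here: operator norms `‖·‖_{∞→1}`, triangular factors `L₁₁, U₁₁`, the growth
factor `ρ_m`, singular values.

References: S. Cortinovis, D. Kressner, S. Massei, *On maximum volume submatrices and cross
approximation for symmetric semidefinite and diagonally dominant matrices*, Linear Algebra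
Appl. 593 (2020) 251–268 (numbering of arXiv:1902.02283); R. A. Horn, C. R. Johnson, *Matrix
Analysis*, 2nd ed., CUP 2013, §0.7.3, §5.6; M. Bebendorf, Numer. Math. 86 (2000), Lemma 6.
AI-produced formalisation (H21 engines group, seat eng-quad-2, 2026-08-21); no facts, no axioms
beyond Mathlib's, no `sorry`.
-/

open Matrix Finset

namespace Literature.LinearAlgebra.Matrix

/-! ### The bordered inverse -/

section Field

variable {K : Type*} [Field K] {m n : Type*} {k : ℕ}

/-- [cite: HornJohnson2013, §0.7.3 ((0.7.3.1), "verified by doing a partitioned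
multiplication by `A` and then simplifying")]; [cite: CortinovisKressnerMassei2020, §3.1 (proof
of Theorem 7: the factors of `A₁₁⁻¹` along complete pivoting)] THE BORDERED INVERSE.  For a
nonsingular pivot block `P = A[r, c]` and a new pivot `(i, j)` with nonzero residual
`γ = (A - Ã) i j`, the inverse of the bordered pivot block `P' = A[(i, r), (j, c)]` is, in the
`vecCons` indexing (new pivot in position `0`),
`P'⁻¹ 0 0 = γ⁻¹`, `P'⁻¹ 0 t⁺ = -γ⁻¹ w_t`, `P'⁻¹ s⁺ 0 = -u_s γ⁻¹`, `P'⁻¹ s⁺ t⁺ = P⁻¹ s t + u_s γ⁻¹ w_t`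
with `w = (A[:, c] P⁻¹) i ·` (column coefficients of the new pivot row) and `u = (P⁻¹ A[r, :]) · j`
(row coefficients of the new pivot column). -/
theorem inv_submatrix_vecCons_vecCons_eq (A : Matrix m n K) (r : Fin k → m) (c : Fin k → n)
    (hP : IsUnit (A.submatrix r c).det) {i : m} {j : n} (hγ : (A - crossInterp A r c) i j ≠ 0) :
    (A.submatrix (vecCons i r) (vecCons j c))⁻¹ =
      Matrix.of (vecCons
        (vecCons ((A - crossInterp A r c) i j)⁻¹ fun t =>
          -(((A - crossInterp A r c) i j)⁻¹ * (A.submatrix id c * (A.submatrix r c)⁻¹) i t))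
        fun s => vecCons
          (-(((A.submatrix r c)⁻¹ * A.submatrix r id) s j * ((A - crossInterp A r c) i j)⁻¹))
          fun t => (A.submatrix r c)⁻¹ s t +
            ((A.submatrix r c)⁻¹ * A.submatrix r id) s j * ((A - crossInterp A r c) i j)⁻¹ *
              (A.submatrix id c * (A.submatrix r c)⁻¹) i t) := by
  apply Matrix.inv_eq_left_inv
  set γ := (A - crossInterp A r c) i j with hγdef
  set C := A.submatrix id c * (A.submatrix r c)⁻¹ with hC
  set R := (A.submatrix r c)⁻¹ * A.submatrix r id with hR
  -- the four identities behind the partitioned multiplication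
  have hCP : ∀ l, ∑ t, C i t * A (r t) (c l) = A i (c l) := by
    intro l
    have hmat : C * A.submatrix r c = A.submatrix id c := by
      rw [hC, Matrix.mul_assoc, Matrix.nonsing_inv_mul _ hP, Matrix.mul_one]
    have h := congr_fun (congr_fun hmat i) l
    rw [Matrix.mul_apply] at h
    simpa only [submatrix_apply, id_eq] using h
  have hCR : ∑ t, C i t * A (r t) j = A i j - γ := by
    rw [hγdef, Matrix.sub_apply, sub_sub_cancel, crossInterp_def, ← hC, Matrix.mul_apply]
    simp only [submatrix_apply, id_eq]
  have hPP : ∀ s l, ∑ t, (A.submatrix r c)⁻¹ s t * A (r t) (c l) =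
      (1 : Matrix (Fin k) (Fin k) K) s l := by
    intro s l
    have h := congr_fun (congr_fun (Matrix.nonsing_inv_mul _ hP) s) l
    rw [Matrix.mul_apply] at h
    simpa only [submatrix_apply] using h
  have hPR : ∀ s, ∑ t, (A.submatrix r c)⁻¹ s t * A (r t) j = R s j := by
    intro s
    rw [hR, Matrix.mul_apply]
    simp only [submatrix_apply, id_eq]
  -- splitting the bordered sums
  have hneg : ∀ (a : K) (g v : Fin k → K),
      ∑ t, -(a * g t) * v t = -a * ∑ t, g t * v t := by
    intro a g v
    rw [Finset.mul_sum]
    exact Finset.sum_congr rfl fun t _ => by ring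
  have hsplit : ∀ (a : K) (f g v : Fin k → K),
      ∑ t, (f t + a * g t) * v t = ∑ t, f t * v t + a * ∑ t, g t * v t := by
    intro a f g v
    rw [Finset.mul_sum, ← Finset.sum_add_distrib]
    exact Finset.sum_congr rfl fun t _ => by ring
  ext a b
  rw [Matrix.mul_apply, Fin.sum_univ_succ]
  induction a using Fin.cases with
  | zero =>
    induction b using Fin.cases with
    | zero =>
      simp only [of_apply, cons_val_zero, cons_val_succ, submatrix_apply, one_apply_eq]
      have h1 := hneg γ⁻¹ (fun t => C i t) (fun t => A (r t) j)
      rw [h1, hCR, show γ⁻¹ * A i j + -γ⁻¹ * (A i j - γ) = γ⁻¹ * γ by ring, inv_mul_cancel₀ hγ]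
    | succ l =>
      simp only [of_apply, cons_val_zero, cons_val_succ, submatrix_apply,
        one_apply_ne (Fin.succ_ne_zero l).symm]
      have h1 := hneg γ⁻¹ (fun t => C i t) (fun t => A (r t) (c l))
      rw [h1, hCP l]
      ring
  | succ s =>
    induction b using Fin.cases with
    | zero =>
      simp only [of_apply, cons_val_zero, cons_val_succ, submatrix_apply,
        one_apply_ne (Fin.succ_ne_zero s)]
      have h1 := hsplit (R s j * γ⁻¹) (fun t => (A.submatrix r c)⁻¹ s t) (fun t => C i t)
        (fun t => A (r t) j)
      rw [h1, hPR s, hCR, show -(R s j * γ⁻¹) * A i j + (R s j + R s j * γ⁻¹ * (A i j - γ)) =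
        R s j - R s j * (γ⁻¹ * γ) by ring, inv_mul_cancel₀ hγ]
      ring
    | succ l =>
      simp only [of_apply, cons_val_zero, cons_val_succ, submatrix_apply]
      have h1 := hsplit (R s j * γ⁻¹) (fun t => (A.submatrix r c)⁻¹ s t) (fun t => C i t)
        (fun t => A (r t) (c l))
      rw [h1, hPP s l, hCP l]
      have h2 : (1 : Matrix (Fin (k + 1)) (Fin (k + 1)) K) s.succ l.succ =
          (1 : Matrix (Fin k) (Fin k) K) s l := by
        simp only [one_apply, Fin.succ_inj]
      rw [h2]
      ring

/-- [cite: HornJohnson2013, §0.7.3 (0.7.3.1)] Bordered inverse, entry `(0, t⁺)`: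
`P'⁻¹ 0 t⁺ = -γ⁻¹ · (A[:, c] P⁻¹) i t`. -/
theorem inv_submatrix_vecCons_vecCons_apply_zero_succ (A : Matrix m n K) (r : Fin k → m)
    (c : Fin k → n) (hP : IsUnit (A.submatrix r c).det) {i : m} {j : n}
    (hγ : (A - crossInterp A r c) i j ≠ 0) (t : Fin k) :
    (A.submatrix (vecCons i r) (vecCons j c))⁻¹ 0 t.succ =
      -(((A - crossInterp A r c) i j)⁻¹ * (A.submatrix id c * (A.submatrix r c)⁻¹) i t) := by
  rw [inv_submatrix_vecCons_vecCons_eq A r c hP hγ]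
  simp

/-- [cite: HornJohnson2013, §0.7.3 (0.7.3.1)] Bordered inverse, entry `(s⁺, 0)`:
`P'⁻¹ s⁺ 0 = -(P⁻¹ A[r, :]) s j · γ⁻¹`. -/
theorem inv_submatrix_vecCons_vecCons_apply_succ_zero (A : Matrix m n K) (r : Fin k → m)
    (c : Fin k → n) (hP : IsUnit (A.submatrix r c).det) {i : m} {j : n}
    (hγ : (A - crossInterp A r c) i j ≠ 0) (s : Fin k) :
    (A.submatrix (vecCons i r) (vecCons j c))⁻¹ s.succ 0 =
      -(((A.submatrix r c)⁻¹ * A.submatrix r id) s j * ((A - crossInterp A r c) i j)⁻¹) := by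
  rw [inv_submatrix_vecCons_vecCons_eq A r c hP hγ]
  simp

/-- [cite: HornJohnson2013, §0.7.3 (0.7.3.1)] Bordered inverse, entry `(s⁺, t⁺)`: the old
inverse plus a rank-one correction, `P'⁻¹ s⁺ t⁺ = P⁻¹ s t + (P⁻¹ A[r, :]) s j · γ⁻¹ · (A[:, c] P⁻¹) i t`
(`P'⁻¹[old, old] = (P - b γ₀⁻¹ cᵀ)⁻¹`, expanded by Sherman–Morrison). -/
theorem inv_submatrix_vecCons_vecCons_apply_succ_succ (A : Matrix m n K) (r : Fin k → m)
    (c : Fin k → n) (hP : IsUnit (A.submatrix r c).det) {i : m} {j : n}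
    (hγ : (A - crossInterp A r c) i j ≠ 0) (s t : Fin k) :
    (A.submatrix (vecCons i r) (vecCons j c))⁻¹ s.succ t.succ =
      (A.submatrix r c)⁻¹ s t +
        ((A.submatrix r c)⁻¹ * A.submatrix r id) s j * ((A - crossInterp A r c) i j)⁻¹ *
          (A.submatrix id c * (A.submatrix r c)⁻¹) i t := by
  rw [inv_submatrix_vecCons_vecCons_eq A r c hP hγ]
  simp

end Field

/-! ### Entry sums of the bordered inverse; distance to singularity -/

section NormedField

variable {K : Type*} [NormedField K] {m n : Type*} {k : ℕ}

/-- The geometric sum `Σ_{s<k} 2^s = 2^k - 1` over `Fin k`. [folklore] -/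
private theorem sum_two_pow_fin_eq_sub (k : ℕ) : ∑ s : Fin k, (2 : ℝ) ^ (s : ℕ) = 2 ^ k - 1 := by
  induction k with
  | zero => simp
  | succ k ih =>
    rw [Fin.sum_univ_castSucc]
    simp only [Fin.val_castSucc, Fin.val_last, ih, pow_succ]
    ring

/-- [cite: CortinovisKressnerMassei2020, §3.1 (proof of Theorem 7: "`‖L₁₁⁻¹‖_{∞→1} ≤
(2^{m+1} - 1) min{|p_1|, …, |p_{m+1}|}⁻¹`, which can be shown by induction on `m`", times
`‖U₁₁⁻¹‖_{1→1} ≤ 2^m`)]; [cite: HornJohnson2013, §0.7.3 (0.7.3.1)] THE ENTRY-SUM RECURSION for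
the bordered inverse: `Σ_{a,b} ‖P'⁻¹ a b‖ ≤ Σ_{s,t} ‖P⁻¹ s t‖ + ‖γ‖⁻¹ (1 + Σ_s ‖u_s‖) (1 + Σ_t ‖w_t‖)`,
`u = (P⁻¹ A[r, :]) · j`, `w = (A[:, c] P⁻¹) i ·` (the induction step of the `∞ → 1` growth bound;
the entry sum dominates `‖·‖_{∞→1}`). -/
theorem sum_norm_inv_submatrix_vecCons_vecCons_le (A : Matrix m n K) (r : Fin k → m)
    (c : Fin k → n) (hP : IsUnit (A.submatrix r c).det) {i : m} {j : n}
    (hγ : (A - crossInterp A r c) i j ≠ 0) :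
    ∑ a, ∑ b, ‖(A.submatrix (vecCons i r) (vecCons j c))⁻¹ a b‖ ≤
      ∑ s, ∑ t, ‖(A.submatrix r c)⁻¹ s t‖ +
        ‖(A - crossInterp A r c) i j‖⁻¹ *
          ((1 + ∑ s, ‖((A.submatrix r c)⁻¹ * A.submatrix r id) s j‖) *
            (1 + ∑ t, ‖(A.submatrix id c * (A.submatrix r c)⁻¹) i t‖)) := by
  rw [inv_submatrix_vecCons_vecCons_eq A r c hP hγ]
  set γ := (A - crossInterp A r c) i j
  set w := fun t => (A.submatrix id c * (A.submatrix r c)⁻¹) i t with hw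
  set u := fun s => ((A.submatrix r c)⁻¹ * A.submatrix r id) s j with hu
  simp only [Fin.sum_univ_succ, of_apply, cons_val_zero, cons_val_succ, norm_neg, norm_mul,
    norm_inv]
  have hst : ∑ s : Fin k, ∑ t : Fin k, ‖(A.submatrix r c)⁻¹ s t + u s * γ⁻¹ * w t‖ ≤
      ∑ s : Fin k, ∑ t : Fin k, (‖(A.submatrix r c)⁻¹ s t‖ + ‖u s‖ * ‖γ‖⁻¹ * ‖w t‖) :=
    Finset.sum_le_sum fun s _ => Finset.sum_le_sum fun t _ =>
      (norm_add_le _ _).trans (by rw [norm_mul, norm_mul, norm_inv])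
  have hexp : ∑ s : Fin k, ∑ t : Fin k, (‖(A.submatrix r c)⁻¹ s t‖ + ‖u s‖ * ‖γ‖⁻¹ * ‖w t‖) =
      ∑ s : Fin k, ∑ t : Fin k, ‖(A.submatrix r c)⁻¹ s t‖ +
        ‖γ‖⁻¹ * ((∑ s : Fin k, ‖u s‖) * ∑ t : Fin k, ‖w t‖) := by
    rw [Finset.sum_mul_sum, Finset.mul_sum, ← Finset.sum_add_distrib]
    refine Finset.sum_congr rfl fun s _ => ?_
    rw [Finset.sum_add_distrib, Finset.mul_sum]
    congr 1
    exact Finset.sum_congr rfl fun t _ => by ring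
  have hrow : ∑ t : Fin k, ‖γ‖⁻¹ * ‖w t‖ = ‖γ‖⁻¹ * ∑ t : Fin k, ‖w t‖ := by
    rw [Finset.mul_sum]
  have hcol : ∑ s : Fin k, (‖u s‖ * ‖γ‖⁻¹ +
      ∑ t : Fin k, ‖(A.submatrix r c)⁻¹ s t + u s * γ⁻¹ * w t‖) =
      ‖γ‖⁻¹ * ∑ s : Fin k, ‖u s‖ +
        ∑ s : Fin k, ∑ t : Fin k, ‖(A.submatrix r c)⁻¹ s t + u s * γ⁻¹ * w t‖ := by
    rw [Finset.sum_add_distrib, Finset.mul_sum]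
    congr 1
    exact Finset.sum_congr rfl fun s _ => by ring
  rw [hrow, hcol]
  have h0 : 0 ≤ ‖γ‖⁻¹ := inv_nonneg.2 (norm_nonneg _)
  nlinarith [hst, hexp, Finset.sum_nonneg (fun s (_ : s ∈ univ) => norm_nonneg (u s)),
    Finset.sum_nonneg (fun t (_ : t ∈ univ) => norm_nonneg (w t))]

/-- [cite: CortinovisKressnerMassei2020, §3.1 (proof of Theorem 7: `‖A₁₁⁻¹‖ ≤ 2^{2m+1} /
min |p_t|` under complete pivoting)]; [cite: Bebendorf2000, §2 Lemma 6 (`|coefficients| ≤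
2^s`)]; [cite: NunezFernandezEtAl2025, App. B.2 (rook conditions)] UNDER ROOK PIVOTING THE
ENTRY SUM OF THE INVERSE PIVOT BLOCK GROWS BY AT MOST `4^k / ‖γ‖` PER STEP: if the first `k`
pivots are rook-pivoted then `Σ ‖u‖, Σ ‖w‖ ≤ 2^k - 1`, so
`Σ_{a,b} ‖P'⁻¹ a b‖ ≤ Σ_{s,t} ‖P⁻¹ s t‖ + 4^k / ‖γ‖` for any new pivot with residual `γ ≠ 0`
(complete pivoting is the special case `IsRookPivoted.cons_of_forall`). -/
theorem IsRookPivoted.sum_norm_inv_submatrix_vecCons_vecCons_le {A : Matrix m n K}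
    {r : Fin k → m} {c : Fin k → n} (h : IsRookPivoted A r c) {i : m} {j : n}
    (hγ : (A - crossInterp A r c) i j ≠ 0) :
    ∑ a, ∑ b, ‖(A.submatrix (vecCons i r) (vecCons j c))⁻¹ a b‖ ≤
      ∑ s, ∑ t, ‖(A.submatrix r c)⁻¹ s t‖ + 4 ^ k / ‖(A - crossInterp A r c) i j‖ := by
  have hP := h.isColumnPivoted.isUnit_det
  refine (Literature.LinearAlgebra.Matrix.sum_norm_inv_submatrix_vecCons_vecCons_le A r c hP
    hγ).trans ?_
  have hu : ∑ s : Fin k, ‖((A.submatrix r c)⁻¹ * A.submatrix r id) s j‖ ≤ 2 ^ k - 1 := by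
    rw [← sum_two_pow_fin_eq_sub k]
    exact Finset.sum_le_sum fun s _ => h.isRowPivoted.norm_inv_submatrix_mul_apply_le_two_pow s j
  have hw : ∑ t : Fin k, ‖(A.submatrix id c * (A.submatrix r c)⁻¹) i t‖ ≤ 2 ^ k - 1 :=
    h.isColumnPivoted.sum_norm_submatrix_mul_inv_apply_le i
  have hγpos : 0 < ‖(A - crossInterp A r c) i j‖ := norm_pos_iff.2 hγ
  have h4 : (4 : ℝ) ^ k = 2 ^ k * 2 ^ k := by
    rw [← mul_pow]; norm_num
  rw [div_eq_inv_mul, h4]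
  have h0u := Finset.sum_nonneg fun s (_ : s ∈ (univ : Finset (Fin k))) =>
    norm_nonneg (((A.submatrix r c)⁻¹ * A.submatrix r id) s j)
  have h0w := Finset.sum_nonneg fun t (_ : t ∈ (univ : Finset (Fin k))) =>
    norm_nonneg ((A.submatrix id c * (A.submatrix r c)⁻¹) i t)
  gcongr <;> linarith

/-- [cite: HornJohnson2013, §5.6 (the exercise preceding Corollary 5.6.17: "if `A` is
nonsingular and `A + B` is singular, then `|||B||| ≥ 1 / |||A⁻¹|||`")];
[cite: CortinovisKressnerMassei2020, §3.1 ((eq. for `γ_{n-1}`): `γ_{n-1}(A) = ‖A⁻¹‖⁻¹_{∞→1}`,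
"relating the distance to singularity to the norm of the inverse")] DISTANCE TO SINGULARITY IN
THE CHEBYSHEV NORM, entry-sum form: if `P` is nonsingular, `F` is singular and every entry of
`P - F` has norm at most `δ`, then `1 ≤ δ · Σ_{a,b} ‖P⁻¹ a b‖` (a kernel vector `v` of `F`
satisfies `v = P⁻¹ (P - F) v`, and `‖(P - F) v‖_∞ ≤ δ ‖v‖₁`). -/
theorem one_le_mul_sum_norm_inv_of_det_eq_zero {ι : Type*} [Fintype ι] [DecidableEq ι]
    {P F : Matrix ι ι K} (hP : IsUnit P.det) (hF : F.det = 0) {δ : ℝ}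
    (hδ : ∀ a b, ‖P a b - F a b‖ ≤ δ) : 1 ≤ δ * ∑ a, ∑ b, ‖P⁻¹ a b‖ := by
  obtain ⟨v, hv0, hFv⟩ := exists_mulVec_eq_zero_iff.2 hF
  -- `v = P⁻¹ ((P - F) v)`
  have hv : v = P⁻¹ *ᵥ ((P - F) *ᵥ v) := by
    rw [sub_mulVec, hFv, sub_zero, mulVec_mulVec, nonsing_inv_mul _ hP, one_mulVec]
  set M : ℝ := ∑ l, ‖v l‖ with hM
  have hMpos : 0 < M := by
    obtain ⟨l, hl⟩ := Function.ne_iff.1 hv0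
    exact lt_of_lt_of_le (norm_pos_iff.2 hl)
      (Finset.single_le_sum (fun l _ => norm_nonneg (v l)) (Finset.mem_univ l))
  have hδ0 : 0 ≤ δ := by
    obtain ⟨l, _⟩ := Function.ne_iff.1 hv0
    exact (norm_nonneg _).trans (hδ l l)
  -- `‖((P - F) v) b‖ ≤ δ M`
  have hE : ∀ b, ‖((P - F) *ᵥ v) b‖ ≤ δ * M := by
    intro b
    rw [mulVec, dotProduct, hM, Finset.mul_sum]
    refine (norm_sum_le _ _).trans (Finset.sum_le_sum fun l _ => ?_)
    rw [norm_mul, Matrix.sub_apply]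
    exact mul_le_mul_of_nonneg_right (hδ b l) (norm_nonneg _)
  -- `‖v a‖ ≤ (Σ_b ‖P⁻¹ a b‖) δ M`
  have ha : ∀ a, ‖v a‖ ≤ (∑ b, ‖P⁻¹ a b‖) * (δ * M) := by
    intro a
    conv_lhs => rw [hv]
    rw [mulVec, dotProduct, Finset.sum_mul]
    refine (norm_sum_le _ _).trans (Finset.sum_le_sum fun b _ => ?_)
    rw [norm_mul]
    exact mul_le_mul_of_nonneg_left (hE b) (norm_nonneg _)
  have hsum : M ≤ (∑ a, ∑ b, ‖P⁻¹ a b‖) * (δ * M) := by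
    rw [hM, Finset.sum_mul]
    exact Finset.sum_le_sum fun a _ => ha a
  by_contra hlt
  rw [not_le] at hlt
  have : (∑ a, ∑ b, ‖P⁻¹ a b‖) * (δ * M) < 1 * M := by
    rw [← mul_assoc, mul_comm _ δ]
    exact mul_lt_mul_of_pos_right hlt hMpos
  linarith

end NormedField

end Literature.LinearAlgebra.Matrix
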